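import Literature.MathematicalPhysics.QuantumManyBody.PeriodizedPotentialHessianBound
import Literature.MathematicalPhysics.QuantumManyBody.PeriodizedPotentialNearestImage
import Literature.MathematicalPhysics.QuantumManyBody.PeriodicBoseGasThm31
import Literature.MathematicalPhysics.QuantumManyBody.DiluteBoseGasUpperBoundLocalization
import Mathlib.Analysis.InnerProductSpace.PiL2
import HarnessLib

/-!
# Route `BECPhaseQuadratureSumRule`, glue `SumRuleChainGlue` (stmt-AtomisticToContinuum-12627) —
# helper: the two inputs of Puff's cubic moment `M₃` and the `m₂`-algebra of the engine

For the engine `CurrentSumRule` (`m₂² ≤ 4 m₁ M₃`) the glue needs `M₃ ≤ N‖k‖⁴(‖k‖² + δ')` with `δ' → 0`: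

* `sum_lintegral_fderiv_single_le` — the directional kinetic term: `Σⱼ ∫|∂_{xⱼ·k}Ψ|² ≤ ‖k‖² ∫|∇Ψ|²`
  (Cauchy–Schwarz in `ℝ³`, pointwise);
* `puffPotential_le` — the potential term: for the smooth class (range `R₀`, edge condition
  `‖D²ṽ‖ ≤ Cₑ√ṽ`, `0 ≤ Cₑ`), `2R₀ < L`, `0 ≤ t ≤ 1` and every `η > 0`,
  `E_Ψ[Σ_{i<j}(1 - cos k·(xᵢ-xⱼ)) |∂_k²(tṽ)^per(xᵢ-xⱼ)|] ≤ (‖k‖⁴/2)·R₀²Cₑ·((η/2)·E_Ψ[#close pairs] +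
  (2η)⁻¹·E_Ψ[Σ_{i<j}(t v)^per])`, where "close" means `|xᵢ - xⱼ - Lm| ≤ R₀` for some `m` (the pair count is
  the periodic interaction of the indicator profile `1_{r ≤ R₀}`): pointwise Puff estimate
  `|e_k(y)-1|²|∂_k²v^per| ≤ ‖k‖⁴ W^per` [Puff1965; Stringari1995 §2.3 (23)] (tree:
  `phase_sq_mul_hessian_le_puffWeight`), `W(r) = r²‖D²(tṽ)(re₀)‖ ≤ R₀² t Cₑ √v(r)` (edge) and
  `t√v ≤ η/2 + tv/(2η)`;
* `le_ofReal_of_sq_le`, `current_div_le` — the real algebra turning `m₂² ≤ 4 m₁ M₃` into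
  `m₂/‖k‖⁴ ≤ 2N(1 + √δ'/‖k‖)`.
-/

noncomputable section

open MeasureTheory Filter Set
open scoped ENNReal NNReal Topology BigOperators

namespace Summit.AtomisticToContinuum.BoseEinsteinCondensation.Theorems.SumRuleChainGlue

open Literature.MathematicalPhysics.QuantumManyBody.BoseGas

/-! ### The directional kinetic term -/

/-- `eⱼ ⊗ k = Σ_c k_c · (eⱼ ⊗ e_c)` in `(ℝ³)^N`. -/
theorem piSingle_eq_sum_smul {N : ℕ} (j : Fin N) (k : Space) :
    (Pi.single j k : Config N) = ∑ c : Fin 3, k c • (Pi.single j (EuclideanSpace.single c (1 : ℝ)) : Config N) := by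
  have hk : k = ∑ c : Fin 3, k c • EuclideanSpace.single c (1 : ℝ) := by
    ext i
    simp [Finset.sum_apply, Pi.single_apply]
  funext i
  simp only [Finset.sum_apply, Pi.smul_apply]
  by_cases hij : i = j
  · subst hij
    simp only [Pi.single_eq_same]
    exact hk
  · simp [hij]

/-- **Pointwise Cauchy–Schwarz**: `Σⱼ |∂_{xⱼ·k}Ψ(X)|² ≤ ‖k‖² |∇Ψ(X)|²`. -/
theorem sum_nnnorm_fderiv_single_sq_le {N : ℕ} (Ψ : Config N → ℂ) (X : Config N) (k : Space) :
    ∑ j : Fin N, ((‖fderiv ℝ Ψ X (Pi.single j k)‖₊ : ℝ≥0∞) ^ 2) ≤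
      ENNReal.ofReal (‖k‖ ^ 2) * kineticDensity Ψ X := by
  unfold kineticDensity
  rw [Finset.mul_sum]
  refine Finset.sum_le_sum fun j _ => ?_
  simp only [coe_nnnorm_sq_eq_ofReal]
  rw [← ENNReal.ofReal_sum_of_nonneg (fun c _ => by positivity), ← ENNReal.ofReal_mul (by positivity)]
  refine ENNReal.ofReal_le_ofReal ?_
  rw [piSingle_eq_sum_smul j k, map_sum]
  simp only [map_smul]
  calc ‖∑ c : Fin 3, k c • fderiv ℝ Ψ X (Pi.single j (EuclideanSpace.single c (1 : ℝ)))‖ ^ 2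
      ≤ (∑ c : Fin 3, ‖k c • fderiv ℝ Ψ X (Pi.single j (EuclideanSpace.single c (1 : ℝ)))‖) ^ 2 := by
        gcongr; exact norm_sum_le _ _
    _ = (∑ c : Fin 3, |k c| * ‖fderiv ℝ Ψ X (Pi.single j (EuclideanSpace.single c (1 : ℝ)))‖) ^ 2 := by
        congr 1
        exact Finset.sum_congr rfl fun c _ => by rw [norm_smul, Real.norm_eq_abs]
    _ ≤ (∑ c : Fin 3, |k c| ^ 2) * ∑ c : Fin 3, ‖fderiv ℝ Ψ X (Pi.single j (EuclideanSpace.single c (1 : ℝ)))‖ ^ 2 :=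
        Finset.sum_mul_sq_le_sq_mul_sq Finset.univ _ _
    _ = ‖k‖ ^ 2 * ∑ c : Fin 3, ‖fderiv ℝ Ψ X (Pi.single j (EuclideanSpace.single c (1 : ℝ)))‖ ^ 2 := by
        rw [EuclideanSpace.real_norm_sq_eq]
        simp only [sq_abs]

/-- **The directional kinetic term of `M₃`**: `Σⱼ ∫_{cell^N} |∂_{xⱼ·k}Ψ|² ≤ ‖k‖² ∫_{cell^N} |∇Ψ|²`. -/
theorem sum_lintegral_fderiv_single_le {N : ℕ} {L : ℝ} (Ψ : PeriodicTrialState N L) (k : Space) :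
    ∑ j : Fin N, ∫⁻ X in cellN N L, ((‖fderiv ℝ Ψ.ψ X (Pi.single j k)‖₊ : ℝ≥0∞) ^ 2) ≤
      ENNReal.ofReal (‖k‖ ^ 2) * ∫⁻ X in cellN N L, kineticDensity Ψ.ψ X := by
  rw [← lintegral_finsetSum _ fun j _ =>
      ((measurable_fderiv_apply_const ℝ Ψ.ψ _).nnnorm.coe_nnreal_ennreal).pow_const _,
    ← lintegral_const_mul' _ _ ENNReal.ofReal_ne_top]
  exact lintegral_mono fun X => sum_nnnorm_fderiv_single_sq_le Ψ.ψ X k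

/-! ### The potential term: Puff's pair estimate, the edge condition, the `η`-split -/

section Potential

variable {v : ℝ → ℝ≥0∞} {R₀ L Cₑ t : ℝ}

/-- `1 - cos(k·y) = ½ |e_p(y) - 1|²` for `k = 2πp/L`. -/
theorem one_sub_cos_inner_eq (L : ℝ) (p : Fin 3 → ℤ) (y : Space) :
    1 - Real.cos (inner ℝ ((2 * Real.pi / L) • latticeVec 1 p) y) =
      ‖cellWave L p y - 1‖ ^ 2 / 2 := by
  set k : Space := (2 * Real.pi / L) • latticeVec 1 p with hk
  have hkc : ∀ c, k c = 2 * Real.pi / L * (p c : ℝ) := fun c => by simp [hk, latticeVec]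
  set θ : ℝ := ∑ c : Fin 3, k c * y c with hθ
  have hinner : inner ℝ k y = θ := by
    rw [hθ, PiLp.inner_apply]
    exact Finset.sum_congr rfl fun c _ => by simp [mul_comm]
  have hwave : cellWave L p y = Complex.exp (θ * Complex.I) := by
    rw [cellWave_apply]
    congr 1
    rw [hθ]
    push_cast
    rw [Finset.mul_sum, Finset.sum_div, Finset.sum_mul]
    refine Finset.sum_congr rfl fun c _ => ?_
    rw [hkc c]
    push_cast
    ring
  have h : ‖Complex.exp (θ * Complex.I) - 1‖ ^ 2 = 2 - 2 * Real.cos θ := by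
    have hre : (Complex.exp (θ * Complex.I)).re = Real.cos θ := Complex.exp_ofReal_mul_I_re θ
    have him : (Complex.exp (θ * Complex.I)).im = Real.sin θ := Complex.exp_ofReal_mul_I_im θ
    rw [Complex.sq_norm, Complex.normSq_apply]
    simp only [Complex.sub_re, Complex.one_re, Complex.sub_im, Complex.one_im, hre, him]
    nlinarith [Real.sin_sq_add_cos_sq θ]
  rw [hinner, hwave, h]
  ring

/-- The real periodisation of `t·v` used in `CurrentSumRule` is `(t·v)^per` read in `ℝ`. -/
theorem tsum_smul_toReal_eq (hfin : ∀ r, v r ≠ ⊤) (ht : 0 ≤ t) (L : ℝ) :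
    (fun z : Space => ∑' m : Fin 3 → ℤ, t * (v ‖z - latticeVec L m‖).toReal) =
      fun z => (periodizedPotential (fun r => ENNReal.ofReal t * v r) L z).toReal := by
  funext z
  rw [periodizedPotential, ENNReal.tsum_toReal_eq fun _ => ENNReal.mul_ne_top ENNReal.ofReal_ne_top (hfin _)]
  refine tsum_congr fun m => ?_
  rw [ENNReal.toReal_mul, ENNReal.toReal_ofReal ht]

/-- **The Puff weight of `t·v` under the edge condition**, compared on `r ≥ 0` with the close-pair indicator
and the potential: `r²‖D²(tṽ)(re₀)‖ ≤ R₀²Cₑ(η/2)·1[r ≤ R₀] + (R₀²Cₑ/(2η))·t v(r)`. -/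
theorem puffWeight_smul_le (hR : ∀ r, R₀ < r → v r = 0) (hfin : ∀ r, v r ≠ ⊤)
    (hC2 : ContDiff ℝ 2 fun x : Space => (v ‖x‖).toReal) (hCₑ : 0 ≤ Cₑ)
    (hedge : ∀ x : Space, ‖iteratedFDeriv ℝ 2 (fun x : Space => (v ‖x‖).toReal) x‖ ≤ Cₑ * Real.sqrt ((v ‖x‖).toReal))
    (ht : 0 ≤ t) (ht1 : t ≤ 1) {η : ℝ} (hη : 0 < η) {r : ℝ} (hr : 0 ≤ r) :
    ENNReal.ofReal (r ^ 2 * ‖iteratedFDeriv ℝ 2 (fun x : Space => ((fun r => ENNReal.ofReal t * v r) ‖x‖).toReal)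
        (r • EuclideanSpace.single (0 : Fin 3) (1 : ℝ))‖) ≤
      ENNReal.ofReal (R₀ ^ 2 * Cₑ * η / 2) * (Set.Iic R₀).indicator (fun _ => (1 : ℝ≥0∞)) r +
        ENNReal.ofReal (R₀ ^ 2 * Cₑ / (2 * η)) * (ENNReal.ofReal t * v r) := by
  set e₀ : Space := EuclideanSpace.single (0 : Fin 3) (1 : ℝ) with he₀
  have hnorm : ‖(r • e₀ : Space)‖ = r := by
    rw [norm_smul, Real.norm_of_nonneg hr, he₀]; simp
  have hfun : (fun x : Space => ((fun r => ENNReal.ofReal t * v r) ‖x‖).toReal) = fun x : Space => t • (v ‖x‖).toReal := by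
    funext x; simp only [ENNReal.toReal_mul, ENNReal.toReal_ofReal ht, smul_eq_mul]
  rw [hfun, iteratedFDeriv_const_smul_apply' hC2.contDiffAt, norm_smul, Real.norm_of_nonneg ht]
  by_cases hrR : r ≤ R₀
  · -- inside the range: edge condition and the `η`-split
    rw [Set.indicator_of_mem (Set.mem_Iic.2 hrR), mul_one]
    have hvr : (v ‖(r • e₀ : Space)‖).toReal = (v r).toReal := by rw [hnorm]
    have hx0 : 0 ≤ (v r).toReal := ENNReal.toReal_nonneg
    have hD : ‖iteratedFDeriv ℝ 2 (fun x : Space => (v ‖x‖).toReal) (r • e₀)‖ ≤ Cₑ * Real.sqrt ((v r).toReal) := by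
      have := hedge (r • e₀); rwa [hvr] at this
    -- `t √x ≤ η/2 + t x/(2η)`
    have hamgm : t * Real.sqrt ((v r).toReal) ≤ η / 2 + t * (v r).toReal / (2 * η) := by
      have hs := Real.sq_sqrt hx0
      have h1 : t * Real.sqrt ((v r).toReal) ≤ η / 2 + t ^ 2 * (v r).toReal / (2 * η) := by
        rw [← sub_nonneg]
        have : η / 2 + t ^ 2 * (v r).toReal / (2 * η) - t * Real.sqrt ((v r).toReal) =
            (η - t * Real.sqrt ((v r).toReal)) ^ 2 / (2 * η) := by
          field_simp
          nlinarith [hs]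
        rw [this]; positivity
      have h2 : t ^ 2 * (v r).toReal ≤ t * (v r).toReal := by
        have : t ^ 2 ≤ t := by nlinarith
        exact mul_le_mul_of_nonneg_right this hx0
      have h3 : t ^ 2 * (v r).toReal / (2 * η) ≤ t * (v r).toReal / (2 * η) :=
        div_le_div_of_nonneg_right h2 (by positivity)
      linarith
    have hreal : r ^ 2 * (t * ‖iteratedFDeriv ℝ 2 (fun x : Space => (v ‖x‖).toReal) (r • e₀)‖) ≤
        R₀ ^ 2 * Cₑ * η / 2 + R₀ ^ 2 * Cₑ / (2 * η) * (t * (v r).toReal) := by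
      have hr2 : r ^ 2 ≤ R₀ ^ 2 := pow_le_pow_left₀ hr hrR 2
      calc r ^ 2 * (t * ‖iteratedFDeriv ℝ 2 (fun x : Space => (v ‖x‖).toReal) (r • e₀)‖)
          ≤ R₀ ^ 2 * (t * (Cₑ * Real.sqrt ((v r).toReal))) := by
            gcongr
        _ = R₀ ^ 2 * Cₑ * (t * Real.sqrt ((v r).toReal)) := by ring
        _ ≤ R₀ ^ 2 * Cₑ * (η / 2 + t * (v r).toReal / (2 * η)) :=
            mul_le_mul_of_nonneg_left hamgm (by positivity)
        _ = R₀ ^ 2 * Cₑ * η / 2 + R₀ ^ 2 * Cₑ / (2 * η) * (t * (v r).toReal) := by ring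
    calc ENNReal.ofReal (r ^ 2 * (t * ‖iteratedFDeriv ℝ 2 (fun x : Space => (v ‖x‖).toReal) (r • e₀)‖))
        ≤ ENNReal.ofReal (R₀ ^ 2 * Cₑ * η / 2 + R₀ ^ 2 * Cₑ / (2 * η) * (t * (v r).toReal)) :=
          ENNReal.ofReal_le_ofReal hreal
      _ = ENNReal.ofReal (R₀ ^ 2 * Cₑ * η / 2) + ENNReal.ofReal (R₀ ^ 2 * Cₑ / (2 * η)) * (ENNReal.ofReal t * v r) := by
          rw [ENNReal.ofReal_add (by positivity) (by positivity), ENNReal.ofReal_mul (by positivity),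
            ENNReal.ofReal_mul ht, ENNReal.ofReal_toReal (hfin r)]
  · -- beyond the range everything vanishes
    push Not at hrR
    have hzero : iteratedFDeriv ℝ 2 (fun x : Space => (v ‖x‖).toReal) (r • e₀) = 0 :=
      iteratedFDeriv_radial_eq_zero_of_lt hR 2 (by rw [hnorm]; exact hrR)
    rw [hzero, norm_zero, mul_zero, mul_zero, ENNReal.ofReal_zero]
    exact bot_le

/-- The periodisation is additive and homogeneous: `(a·f + b·g)^per = a f^per + b g^per`. -/
theorem periodizedPotential_add_mul (f g : ℝ → ℝ≥0∞) (a b : ℝ≥0∞) (L : ℝ) (z : Space) :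
    periodizedPotential (fun r => a * f r + b * g r) L z = a * periodizedPotential f L z + b * periodizedPotential g L z := by
  simp only [periodizedPotential]
  rw [ENNReal.tsum_add, ENNReal.tsum_mul_left, ENNReal.tsum_mul_left]

/-- Monotonicity of the periodisation along `r ≥ 0` (only non-negative arguments occur). -/
theorem periodizedPotential_mono_nonneg {f g : ℝ → ℝ≥0∞} (h : ∀ r, 0 ≤ r → f r ≤ g r) (L : ℝ) (z : Space) :
    periodizedPotential f L z ≤ periodizedPotential g L z :=
  ENNReal.tsum_le_tsum fun _ => h _ (norm_nonneg _)

/-- **The potential term of `M₃`** (the Puff pair estimate with the edge condition and the `η`-split):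
`E_Ψ[Σ_{i<j}(1 - cos k·(xᵢ-xⱼ))|∂_k²(tṽ)^per(xᵢ-xⱼ)|] ≤ (‖k‖⁴/2)·(R₀²Cₑ(η/2)·E_Ψ[#close pairs] +
(R₀²Cₑ/(2η))·E_Ψ[Σ_{i<j}(tv)^per])`. -/
theorem puffPotential_le {N : ℕ} (hmeas : Measurable v) (hR : ∀ r, R₀ < r → v r = 0)
    (h2R : 2 * R₀ < L) (hL : 0 < L) (hfin : ∀ r, v r ≠ ⊤) (hC2 : ContDiff ℝ 2 fun x : Space => (v ‖x‖).toReal)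
    (hCₑ : 0 ≤ Cₑ)
    (hedge : ∀ x : Space, ‖iteratedFDeriv ℝ 2 (fun x : Space => (v ‖x‖).toReal) x‖ ≤ Cₑ * Real.sqrt ((v ‖x‖).toReal))
    (ht : 0 ≤ t) (ht1 : t ≤ 1) {η : ℝ} (hη : 0 < η) (p : Fin 3 → ℤ) (Ψ : PeriodicTrialState N L) :
    (∫⁻ X in cellN N L, (∑ i : Fin N, ∑ j : Fin N with i < j, ENNReal.ofReal
        ((1 - Real.cos (inner ℝ ((2 * Real.pi / L) • latticeVec 1 p) (X i - X j))) *
          |fderiv ℝ (fun z : Space => fderiv ℝ (fun z : Space => ∑' m : Fin 3 → ℤ, t * (v ‖z - latticeVec L m‖).toReal) z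
            ((2 * Real.pi / L) • latticeVec 1 p)) (X i - X j) ((2 * Real.pi / L) • latticeVec 1 p)|)) *
        (‖Ψ.ψ X‖₊ : ℝ≥0∞) ^ 2) ≤
      ENNReal.ofReal (‖(2 * Real.pi / L) • latticeVec 1 p‖ ^ 4 / 2) *
        (ENNReal.ofReal (R₀ ^ 2 * Cₑ * η / 2) *
            (∫⁻ X in cellN N L, periodicInteraction ((Set.Iic R₀).indicator fun _ => (1 : ℝ≥0∞)) L X *
              (‖Ψ.ψ X‖₊ : ℝ≥0∞) ^ 2) +
          ENNReal.ofReal (R₀ ^ 2 * Cₑ / (2 * η)) *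
            (∫⁻ X in cellN N L, periodicInteraction (fun r => ENNReal.ofReal t * v r) L X * (‖Ψ.ψ X‖₊ : ℝ≥0∞) ^ 2)) := by
  set k : Space := (2 * Real.pi / L) • latticeVec 1 p with hk
  set w : ℝ → ℝ≥0∞ := fun r => ENNReal.ofReal t * v r with hw
  -- the Puff weight of `w` and its comparison profile
  set W : ℝ → ℝ≥0∞ := fun r : ℝ => ENNReal.ofReal (r ^ 2 *
    ‖iteratedFDeriv ℝ 2 (fun x : Space => (w ‖x‖).toReal) (r • EuclideanSpace.single (0 : Fin 3) (1 : ℝ))‖) with hW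
  set a : ℝ≥0∞ := ENNReal.ofReal (R₀ ^ 2 * Cₑ * η / 2) with ha
  set b : ℝ≥0∞ := ENNReal.ofReal (R₀ ^ 2 * Cₑ / (2 * η)) with hb
  set ind : ℝ → ℝ≥0∞ := (Set.Iic R₀).indicator fun _ => (1 : ℝ≥0∞) with hind
  have hwR : ∀ r, R₀ < r → w r = 0 := fun r hr => by simp only [hw, hR r hr, mul_zero]
  have hwfin : ∀ r, w r ≠ ⊤ := fun r => ENNReal.mul_ne_top ENNReal.ofReal_ne_top (hfin r)
  have hwC2 : ContDiff ℝ 2 fun x : Space => (w ‖x‖).toReal := by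
    have : (fun x : Space => (w ‖x‖).toReal) = fun x : Space => t • (v ‖x‖).toReal := by
      funext x; simp only [hw, ENNReal.toReal_mul, ENNReal.toReal_ofReal ht, smul_eq_mul]
    rw [this]; exact hC2.const_smul t
  have hWR : ∀ r, R₀ < r → W r = 0 := fun r hr => puffWeight_eq_zero_of_lt hwR hr
  have hWle : ∀ r, 0 ≤ r → W r ≤ a * ind r + b * w r := fun r hr =>
    puffWeight_smul_le hR hfin hC2 hCₑ hedge ht ht1 hη hr
  -- pointwise bound of the integrand
  have hpt : ∀ X : Config N, (∑ i : Fin N, ∑ j : Fin N with i < j, ENNReal.ofReal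
      ((1 - Real.cos (inner ℝ k (X i - X j))) *
        |fderiv ℝ (fun z : Space => fderiv ℝ (fun z : Space => ∑' m : Fin 3 → ℤ, t * (v ‖z - latticeVec L m‖).toReal) z k)
          (X i - X j) k|)) * (‖Ψ.ψ X‖₊ : ℝ≥0∞) ^ 2 ≤
      ENNReal.ofReal (‖k‖ ^ 4 / 2) * ((a * periodicInteraction ind L X + b * periodicInteraction w L X) *
        (‖Ψ.ψ X‖₊ : ℝ≥0∞) ^ 2) := by
    intro X
    rw [← mul_assoc]
    refine mul_le_mul_of_nonneg_right ?_ bot_le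
    rw [periodicInteraction, periodicInteraction, Finset.mul_sum, Finset.mul_sum, ← Finset.sum_add_distrib, Finset.mul_sum]
    refine Finset.sum_le_sum fun i _ => ?_
    rw [Finset.mul_sum, Finset.mul_sum, ← Finset.sum_add_distrib, Finset.mul_sum]
    refine Finset.sum_le_sum fun j _ => ?_
    set y : Space := X i - X j with hy
    -- Puff's estimate at `y` for the profile `w`
    have hPuff := phase_sq_mul_hessian_le_puffWeight hwR h2R hL hwC2 p y
    rw [← hk] at hPuff
    have hper : (fun z : Space => ∑' m : Fin 3 → ℤ, t * (v ‖z - latticeVec L m‖).toReal) =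
        fun z => (periodizedPotential w L z).toReal := tsum_smul_toReal_eq hfin ht L
    rw [hper, one_sub_cos_inner_eq L p y]
    have hWtop : periodizedPotential W L y ≠ ⊤ :=
      periodizedPotential_ne_top_of_range hWR h2R hL (fun r => ENNReal.ofReal_ne_top) y
    calc ENNReal.ofReal (‖cellWave L p y - 1‖ ^ 2 / 2 *
          |fderiv ℝ (fun z : Space => fderiv ℝ (fun z => (periodizedPotential w L z).toReal) z k) y k|)
        ≤ ENNReal.ofReal (‖k‖ ^ 4 / 2 * (periodizedPotential W L y).toReal) := by
          refine ENNReal.ofReal_le_ofReal ?_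
          have : ‖cellWave L p y - 1‖ ^ 2 / 2 *
              |fderiv ℝ (fun z : Space => fderiv ℝ (fun z => (periodizedPotential w L z).toReal) z k) y k| =
              (‖cellWave L p y - 1‖ ^ 2 *
                |fderiv ℝ (fun z : Space => fderiv ℝ (fun z => (periodizedPotential w L z).toReal) z k) y k|) / 2 := by ring
          rw [this, div_mul_eq_mul_div]
          exact div_le_div_of_nonneg_right hPuff (by norm_num)
      _ = ENNReal.ofReal (‖k‖ ^ 4 / 2) * periodizedPotential W L y := by
          rw [ENNReal.ofReal_mul (by positivity), ENNReal.ofReal_toReal hWtop]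
      _ ≤ ENNReal.ofReal (‖k‖ ^ 4 / 2) * (a * periodizedPotential ind L y + b * periodizedPotential w L y) := by
          refine mul_le_mul_of_nonneg_left ?_ bot_le
          rw [← periodizedPotential_add_mul]
          exact periodizedPotential_mono_nonneg hWle L y
  -- integrate
  have hmI : Measurable fun X : Config N => periodicInteraction ind L X * (‖Ψ.ψ X‖₊ : ℝ≥0∞) ^ 2 :=
    (measurable_periodicInteraction (measurable_const.indicator measurableSet_Iic) L).mul Ψ.measurable_normSq
  have hmW : Measurable fun X : Config N => periodicInteraction w L X * (‖Ψ.ψ X‖₊ : ℝ≥0∞) ^ 2 :=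
    (measurable_periodicInteraction (measurable_const.mul hmeas) L).mul Ψ.measurable_normSq
  calc _ ≤ ∫⁻ X in cellN N L, ENNReal.ofReal (‖k‖ ^ 4 / 2) *
        ((a * periodicInteraction ind L X + b * periodicInteraction w L X) * (‖Ψ.ψ X‖₊ : ℝ≥0∞) ^ 2) :=
        lintegral_mono hpt
    _ = ENNReal.ofReal (‖k‖ ^ 4 / 2) * (a * (∫⁻ X in cellN N L, periodicInteraction ind L X * (‖Ψ.ψ X‖₊ : ℝ≥0∞) ^ 2) +
          b * (∫⁻ X in cellN N L, periodicInteraction w L X * (‖Ψ.ψ X‖₊ : ℝ≥0∞) ^ 2)) := by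
        rw [lintegral_const_mul' _ _ ENNReal.ofReal_ne_top]
        congr 1
        have hsplit : ∀ X : Config N, (a * periodicInteraction ind L X + b * periodicInteraction w L X) *
            (‖Ψ.ψ X‖₊ : ℝ≥0∞) ^ 2 = a * (periodicInteraction ind L X * (‖Ψ.ψ X‖₊ : ℝ≥0∞) ^ 2) +
              b * (periodicInteraction w L X * (‖Ψ.ψ X‖₊ : ℝ≥0∞) ^ 2) := fun X => by ring
        simp_rw [hsplit]
        have hm1 : Measurable fun X : Config N => a * (periodicInteraction ind L X * (‖Ψ.ψ X‖₊ : ℝ≥0∞) ^ 2) :=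
          hmI.const_mul a
        rw [lintegral_add_left hm1, lintegral_const_mul a hmI, lintegral_const_mul b hmW]

end Potential

/-! ### The real algebra of the engine -/

/-- `x² ≤ b²` in `ℝ≥0∞` with `b ≥ 0` real forces `x ≤ b`. -/
theorem le_ofReal_of_sq_le {x : ℝ≥0∞} {b : ℝ} (hb : 0 ≤ b) (h : x ^ 2 ≤ ENNReal.ofReal (b ^ 2)) :
    x ≤ ENNReal.ofReal b := by
  have hx : x ≠ ⊤ := by
    intro hx
    rw [hx, ENNReal.top_pow two_ne_zero] at h
    exact ENNReal.ofReal_ne_top (top_le_iff.1 h)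
  rw [← ENNReal.ofReal_toReal hx] at h ⊢
  rw [← ENNReal.ofReal_pow ENNReal.toReal_nonneg] at h
  have h2 := (ENNReal.ofReal_le_ofReal_iff (by positivity)).1 h
  exact ENNReal.ofReal_le_ofReal ((pow_le_pow_iff_left₀ ENNReal.toReal_nonneg hb two_ne_zero).1 h2)

/-- **From the engine to the infrared summand**: if `m₂² ≤ 4N²‖k‖⁶(‖k‖² + δ')` (i.e. `m₂² ≤ 4·m₁·M₃` with
`m₁ = N‖k‖²` and `M₃ ≤ N‖k‖⁴(‖k‖² + δ')`), then `m₂/‖k‖⁴ ≤ 2N(1 + √δ'/‖k‖)`. -/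
theorem current_div_le {m₂ : ℝ≥0∞} {N k δ : ℝ} (hN : 0 ≤ N) (hk : 0 < k) (hδ : 0 ≤ δ)
    (h : m₂ ^ 2 ≤ ENNReal.ofReal (4 * N ^ 2 * k ^ 6 * (k ^ 2 + δ))) :
    m₂ / ENNReal.ofReal (k ^ 4) ≤ ENNReal.ofReal (2 * N * (1 + Real.sqrt δ / k)) := by
  have hs : 0 ≤ Real.sqrt (k ^ 2 + δ) := Real.sqrt_nonneg _
  have hb : 0 ≤ 2 * N * k ^ 3 * Real.sqrt (k ^ 2 + δ) := by positivity
  have hsq : (2 * N * k ^ 3 * Real.sqrt (k ^ 2 + δ)) ^ 2 = 4 * N ^ 2 * k ^ 6 * (k ^ 2 + δ) := by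
    rw [mul_pow, Real.sq_sqrt (by positivity)]; ring
  have h1 : m₂ ≤ ENNReal.ofReal (2 * N * k ^ 3 * Real.sqrt (k ^ 2 + δ)) := le_ofReal_of_sq_le hb (by rwa [hsq])
  have hk4 : 0 < k ^ 4 := by positivity
  calc m₂ / ENNReal.ofReal (k ^ 4) ≤ ENNReal.ofReal (2 * N * k ^ 3 * Real.sqrt (k ^ 2 + δ)) / ENNReal.ofReal (k ^ 4) := by
        gcongr
    _ = ENNReal.ofReal (2 * N * k ^ 3 * Real.sqrt (k ^ 2 + δ) / k ^ 4) := (ENNReal.ofReal_div_of_pos hk4).symm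
    _ ≤ ENNReal.ofReal (2 * N * (1 + Real.sqrt δ / k)) := by
        refine ENNReal.ofReal_le_ofReal ?_
        have h2 : Real.sqrt (k ^ 2 + δ) ≤ k + Real.sqrt δ := by
          rw [Real.sqrt_le_left (by positivity)]
          have := Real.sq_sqrt hδ
          nlinarith [Real.sqrt_nonneg δ, hk.le]
        rw [div_le_iff₀ hk4]
        have : 2 * N * (1 + Real.sqrt δ / k) * k ^ 4 = 2 * N * k ^ 3 * (k + Real.sqrt δ) := by
          field_simp
        rw [this]
        exact mul_le_mul_of_nonneg_left h2 (by positivity)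

end Summit.AtomisticToContinuum.BoseEinsteinCondensation.Theorems.SumRuleChainGlue

end
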